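import Summits.AnomalousDissipation.AnomalousDissipation.Theorems.SolenoidalFractalHomogenisationLagrangianStepFrameTestTransport
import Summits.AnomalousDissipation.AnomalousDissipation.Theorems.SolenoidalFractalHomogenisationLagrangianStepFrameClosedPiola
import Literature.Analysis.ODE.TorusFlowFrameRegularityHigher
import Literature.Analysis.FunctionSpaces.SpaceTimeSliceDerivatives
import Literature.Analysis.FunctionSpaces.TorusWeakFormBookkeeping
import HarnessLib

/-!
# K1L_D (stmt-AnomalousDissipation-27980), `stub_Z7_alphaBeta` α-provider, (T1) sub-target (C4) of memos L15/L16: the Eulerian test read in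
# the CLAMPED moving frame is a time-Lipschitz space-smooth test (helper; `--supports … --as helper`; lead-k1l-onelevel-p1 g5)

Piece `[jR, t]` of the closed refresh window (`jR < t ≤ jR + R`), cell clock `a = a (m+1)`, base `σ₁ ∈ [0, a(t−jR))`, horizon
`T_c = a(t−jR) − σ₁`.  For an Eulerian (cell-time) space–time test `Φ` the FRAME TEST is
`Ψ τ y := Φ τ (X m (jR + clamp(σ₁+τ)/a) jR y)`, `clamp r = max 0 (min r (a(t−jR)))` (memo L16 §3).  This file proves the regularity half of
its admissibility in the distorted weak class: §1 slice-derivative bounds of space–time tests on compact time sets; §2 the three Landau clauses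
of `Ψ` (continuous lift, smooth slices, time-uniform all-order bounds on compact time sets — the composite bounds of
`TorusFlow.exists_norm_iteratedFDeriv_comp_flow_le` with the CLOSED-window displacement clauses) hence joint continuity of every iterated space
derivative; §3 the time-Lipschitz bound on `[0, T_c]` from (C3) `hasDerivAt_test_comp_flow`; §4 **`isLipschitzSpaceTimeTest_frameTest`**.
NOT a proof of the stub, of the crux, or of AD; rung F-D1.A0.
-/

set_option linter.dupNamespace false  -- the summit-side namespace `Summit.AnomalousDissipation.AnomalousDissipation.…` repeats a component by design (D-0017)

noncomputable section

namespace Summit.AnomalousDissipation.AnomalousDissipation.Theorems.SolenoidalFractalHomogenisation.LagrangianStep.FrameConj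

open Set Function Filter MeasureTheory Topology
open scoped NNReal ContDiff
open Literature.Analysis Literature.Analysis.ODE Literature.Analysis.ODE.TorusFlow Literature.Analysis.FunctionSpaces
open Literature.Analysis.FunctionSpaces.Torus
open Literature.Analysis.FluidPDE Literature.Analysis.FluidPDE.LatticeShear
open Literature.Analysis.FluidPDE.LatticeShear (LagrangianLatticeCarrier)

variable {k : ℕ}

/-! ## §1 Slice-derivative bounds of space–time tests on compact time sets -/

section SliceBounds

variable {F : Type*} [NormedAddCommGroup F] [NormedSpace ℝ F]

/-- The canonical representative of a point of `𝕋³` has norm `≤ 2` (coordinates in `[0,1)`). -/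
theorem norm_repr_le_two (x : UnitAddTorus (Fin 3)) : ‖repr x‖ ≤ 2 := by
  rw [EuclideanSpace.norm_eq]
  have h : ∑ i, ‖repr x i‖ ^ 2 ≤ 3 := by
    have hi : ∀ i, ‖repr x i‖ ^ 2 ≤ 1 := fun i => by
      have h := repr_apply_mem_Ico x i
      rw [Real.norm_eq_abs, abs_of_nonneg h.1, sq_le_one_iff₀ h.1]
      exact h.2.le
    calc ∑ i, ‖repr x i‖ ^ 2 ≤ ∑ _i : Fin 3, (1 : ℝ) := Finset.sum_le_sum fun i _ => hi i
      _ = 3 := by simp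
  calc Real.sqrt (∑ i, ‖repr x i‖ ^ 2) ≤ Real.sqrt 4 := Real.sqrt_le_sqrt (by linarith)
    _ = 2 := by rw [show (4 : ℝ) = 2 ^ 2 by norm_num, Real.sqrt_sq (by norm_num)]

/-- **Slice-derivative bounds on compact time sets**: for a field with `C^∞` space–time lift and a compact `K ⊆ ℝ`, every iterated derivative
of the periodic lifts of the slices `Φ t`, `t ∈ K`, is bounded uniformly (continuity of `Dⁿ(stLift Φ)` on `K × closedBall 0 2` and
periodicity). -/
theorem exists_norm_iteratedFDeriv_lift_le_of_isCompact {Φ : ℝ → UnitAddTorus (Fin 3) → F} (hΦ : ContDiff ℝ ∞ (stLift Φ))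
    {K : Set ℝ} (hK : IsCompact K) (n : ℕ) :
    ∃ C : ℝ, ∀ t ∈ K, ∀ v, ‖iteratedFDeriv ℝ n (lift (Φ t)) v‖ ≤ C := by
  have hQ : IsCompact (K ×ˢ Metric.closedBall (0 : EuclideanSpace ℝ (Fin 3)) 2) := hK.prod (isCompact_closedBall _ _)
  obtain ⟨M, -, hM⟩ := exists_forall_norm_iteratedFDeriv_slice_le (hΦ.of_le (by exact_mod_cast le_top) : ContDiff ℝ n (stLift Φ))
    hQ (le_refl n)
  refine ⟨M, fun t ht v => ?_⟩
  -- periodicity: evaluate at the representative of `proj v`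
  have hper := isLatticePeriodic_iteratedFDeriv_lift_gen (Φ t) n
  have hv : iteratedFDeriv ℝ n (lift (Φ t)) v = iteratedFDeriv ℝ n (lift (Φ t)) (repr (proj v)) :=
    IsLatticePeriodic.eq_of_proj_eq_holds hper (by rw [proj_repr])
  rw [hv]
  have hmem : (t, repr (proj v)) ∈ K ×ˢ Metric.closedBall (0 : EuclideanSpace ℝ (Fin 3)) 2 :=
    mk_mem_prod ht (by rw [Metric.mem_closedBall, dist_zero_right]; exact norm_repr_le_two _)
  exact hM (t, repr (proj v)) hmem

end SliceBounds

/-! ## §2 The Landau clauses of the frame test and joint continuity of its space derivatives -/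

section FrameTest

variable {Φ : ℝ → UnitAddTorus (Fin 3) → EuclideanSpace ℝ (Fin 3)}

/-- The clamped flow time lies in the closed piece: `clamp(r)/a ∈ [0, t − jR]`. -/
theorem clamp_div_mem (E : LagrangianLatticeCarrier k) (m : ℕ) {w t : ℝ} (hwt : w ≤ t) (r : ℝ) :
    max 0 (min r (E.a (m + 1) * (t - w))) / E.a (m + 1) ∈ Icc 0 (t - w) := by
  have ha : 0 < E.a (m + 1) := E.a_pos (m + 1)
  refine ⟨div_nonneg (le_max_left _ _) ha.le, ?_⟩
  rw [div_le_iff₀ ha]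
  have : max 0 (min r (E.a (m + 1) * (t - w))) ≤ E.a (m + 1) * (t - w) :=
    max_le (mul_nonneg ha.le (by linarith)) (min_le_right _ _)
  linarith [mul_comm (E.a (m + 1)) (t - w)]

/-- The clamped flow time is continuous in the frame time. -/
theorem continuous_clamp_div (E : LagrangianLatticeCarrier k) (m : ℕ) (w t σ₁ : ℝ) :
    Continuous fun τ : ℝ => w + max 0 (min (σ₁ + τ) (E.a (m + 1) * (t - w))) / E.a (m + 1) := by
  fun_prop

/-- Smooth slices of the frame test. -/
theorem isSmooth_frameTest_slice (E : LagrangianLatticeCarrier k) (hR : E.LevelRegular) (m : ℕ) (w t' : ℝ)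
    {φ : UnitAddTorus (Fin 3) → EuclideanSpace ℝ (Fin 3)} (hφ : IsSmooth φ) :
    IsSmooth (fun y => φ (E.X m t' w y)) :=
  isSmooth_comp_add_proj hφ (hR.isSmooth_disp m t' w)

/-- Joint continuity of the frame test. -/
theorem continuous_uncurry_frameTest (E : LagrangianLatticeCarrier k) (hR : E.LevelRegular) (m : ℕ) (w t σ₁ : ℝ)
    (hΦ : Continuous (uncurry Φ)) :
    Continuous (uncurry fun τ y => Φ τ (E.X m (w + max 0 (min (σ₁ + τ) (E.a (m + 1) * (t - w))) / E.a (m + 1)) w y)) := by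
  have h : (uncurry fun τ y => Φ τ (E.X m (w + max 0 (min (σ₁ + τ) (E.a (m + 1) * (t - w))) / E.a (m + 1)) w y))
      = uncurry Φ ∘ fun p : ℝ × UnitAddTorus (Fin 3) =>
          (p.1, E.X m (w + max 0 (min (σ₁ + p.1) (E.a (m + 1) * (t - w))) / E.a (m + 1)) w p.2) := by
    funext p; rfl
  rw [h]
  refine hΦ.comp (continuous_fst.prodMk ?_)
  exact (continuous_X_uncurry E hR m w).comp (((continuous_clamp_div E m w t σ₁).comp continuous_fst).prodMk continuous_snd)

/-- Continuity of the space–time lift of the frame test. -/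
theorem continuous_stLift_frameTest (E : LagrangianLatticeCarrier k) (hR : E.LevelRegular) (m : ℕ) (w t σ₁ : ℝ)
    (hΦ : Continuous (uncurry Φ)) :
    Continuous (stLift fun τ y => Φ τ (E.X m (w + max 0 (min (σ₁ + τ) (E.a (m + 1) * (t - w))) / E.a (m + 1)) w y)) := by
  have h : stLift (fun τ y => Φ τ (E.X m (w + max 0 (min (σ₁ + τ) (E.a (m + 1) * (t - w))) / E.a (m + 1)) w y))
      = (uncurry fun τ y => Φ τ (E.X m (w + max 0 (min (σ₁ + τ) (E.a (m + 1) * (t - w))) / E.a (m + 1)) w y)) ∘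
          Prod.map id proj := by
    funext p; rfl
  rw [h]
  exact (continuous_uncurry_frameTest E hR m w t σ₁ hΦ).comp (continuous_id.prodMap continuous_proj)

/-- **Time-uniform all-order bounds of the frame test on compact time sets** (`TorusFlow.exists_norm_iteratedFDeriv_comp_flow_le` on the time
shift `r ↦ r − n` of `[−n, n]`, with the closed-window displacement clauses). -/
theorem exists_norm_iteratedFDeriv_frameTest_le (E : LagrangianLatticeCarrier k) (hR : E.LevelRegular) (m : ℕ) (j : ℤ) {t : ℝ}
    (hjt : (j : ℝ) * E.refresh (m + 1) ≤ t) (htR : t ≤ (j : ℝ) * E.refresh (m + 1) + E.refresh (m + 1)) (σ₁ : ℝ)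
    (hΦ : ContDiff ℝ ∞ (stLift Φ)) (N : ℕ) (n : ℕ) :
    ∃ C : ℝ, ∀ τ ∈ Icc (-(N : ℝ)) N, ∀ v,
      ‖iteratedFDeriv ℝ n (lift fun y => Φ τ (E.X m ((j : ℝ) * E.refresh (m + 1) +
        max 0 (min (σ₁ + τ) (E.a (m + 1) * (t - (j : ℝ) * E.refresh (m + 1)))) / E.a (m + 1)) ((j : ℝ) * E.refresh (m + 1)) y)) v‖ ≤ C := by
  set w : ℝ := (j : ℝ) * E.refresh (m + 1) with hw
  -- shifted outer field and displacement on `[0, 2N]`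
  set b : ℝ → UnitAddTorus (Fin 3) → EuclideanSpace ℝ (Fin 3) := fun r => Φ (r - N) with hb
  set D : ℝ → UnitAddTorus (Fin 3) → EuclideanSpace ℝ (Fin 3) :=
    fun r => E.disp m (w + max 0 (min (σ₁ + (r - N)) (E.a (m + 1) * (t - w))) / E.a (m + 1)) w with hD
  have hbs : ∀ r ∈ Icc (0 : ℝ) (2 * N), IsSmooth (b r) := fun r _ => by
    show ContDiff ℝ ∞ (lift (Φ (r - N)))
    exact hΦ.comp ((contDiff_const).prodMk contDiff_id)
  have hbB : ∀ n' : ℕ, ∃ C : ℝ, ∀ r ∈ Icc (0 : ℝ) (2 * N), ∀ y, ‖iteratedFDeriv ℝ n' (lift (b r)) y‖ ≤ C := by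
    intro n'
    obtain ⟨C, hC⟩ := exists_norm_iteratedFDeriv_lift_le_of_isCompact hΦ (isCompact_Icc : IsCompact (Icc (-(N : ℝ)) N)) n'
    exact ⟨C, fun r hr y => hC (r - N) ⟨by linarith [hr.1], by linarith [hr.2]⟩ y⟩
  obtain ⟨_, hDs', hDB'⟩ := window_disp_clauses_closed E hR m j (T := t - w) (by linarith)
  have hmemu : ∀ r : ℝ, max 0 (min (σ₁ + (r - N)) (E.a (m + 1) * (t - w))) / E.a (m + 1) ∈ Icc 0 (t - w) :=
    fun r => clamp_div_mem E m hjt _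
  have hDs : ∀ r ∈ Icc (0 : ℝ) (2 * N), IsSmooth (D r) := fun r _ => hDs' _ (hmemu r)
  have hDB : ∀ n' : ℕ, ∃ C : ℝ, ∀ r ∈ Icc (0 : ℝ) (2 * N), ∀ y, ‖iteratedFDeriv ℝ n' (lift (D r)) y‖ ≤ C := by
    intro n'
    obtain ⟨C, hC⟩ := hDB' n'
    exact ⟨C, fun r _ y => hC _ (hmemu r) y⟩
  obtain ⟨C, hC⟩ := exists_norm_iteratedFDeriv_comp_flow_le hbs hbB hDs hDB n
  refine ⟨C, fun τ hτ v => ?_⟩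
  have hr : τ + N ∈ Icc (0 : ℝ) (2 * N) := ⟨by linarith [hτ.1], by linarith [hτ.2]⟩
  have h := hC (τ + N) hr v
  have e : (fun x => b (τ + N) (x + proj (D (τ + N) x))) = fun y => Φ τ (E.X m (w +
      max 0 (min (σ₁ + τ) (E.a (m + 1) * (t - w))) / E.a (m + 1)) w y) := by
    funext y
    simp only [hb, hD, add_sub_cancel_right]
    rfl
  rw [e] at h
  exact h

/-- **Joint continuity of every iterated space derivative of the frame test** (Landau on each `[−N, N]`). -/
theorem continuous_uncurry_iterPartialDeriv_frameTest (E : LagrangianLatticeCarrier k) (hR : E.LevelRegular) (m : ℕ) (j : ℤ) {t : ℝ}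
    (hjt : (j : ℝ) * E.refresh (m + 1) ≤ t) (htR : t ≤ (j : ℝ) * E.refresh (m + 1) + E.refresh (m + 1)) (σ₁ : ℝ)
    (hΦ : ContDiff ℝ ∞ (stLift Φ)) (l : List (Fin 3)) :
    Continuous (uncurry fun τ y => iterPartialDeriv l (fun y => Φ τ (E.X m ((j : ℝ) * E.refresh (m + 1) +
        max 0 (min (σ₁ + τ) (E.a (m + 1) * (t - (j : ℝ) * E.refresh (m + 1)))) / E.a (m + 1)) ((j : ℝ) * E.refresh (m + 1)) y)) y) := by
  set w : ℝ := (j : ℝ) * E.refresh (m + 1) with hw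
  set Ψ : ℝ → UnitAddTorus (Fin 3) → EuclideanSpace ℝ (Fin 3) :=
    fun τ y => Φ τ (E.X m (w + max 0 (min (σ₁ + τ) (E.a (m + 1) * (t - w))) / E.a (m + 1)) w y) with hΨ
  have hΦc : Continuous (uncurry Φ) := continuous_uncurry_of_continuous_stLift hΦ.continuous
  have hcont : Continuous (stLift Ψ) := continuous_stLift_frameTest E hR m w t σ₁ hΦc
  have hsl : ∀ τ, IsSmooth (Ψ τ) := fun τ => isSmooth_frameTest_slice E hR m w _ (by
    show ContDiff ℝ ∞ (lift (Φ τ)); exact hΦ.comp ((contDiff_const).prodMk contDiff_id))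
  -- continuity of the lift of `∂^l Ψ` on every slab `[−N, N] × ℝ³`
  have hslab : ∀ N : ℕ, ContinuousOn (stLift fun τ => iterPartialDeriv l (Ψ τ)) (Icc (-(N : ℝ)) N ×ˢ univ) := fun N =>
    continuousOn_stLift_iterPartialDeriv (S := Icc (-(N : ℝ)) N) (hcont.continuousOn) (fun τ _ => hsl τ)
      (fun n => exists_norm_iteratedFDeriv_frameTest_le E hR m j hjt htR σ₁ hΦ N n) l
  have hglob : Continuous (stLift fun τ => iterPartialDeriv l (Ψ τ)) := by
    refine continuous_iff_continuousAt.2 fun p => ?_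
    obtain ⟨N, hN⟩ := exists_nat_gt |p.1|
    have hmem : Icc (-(N : ℝ)) N ×ˢ (univ : Set (EuclideanSpace ℝ (Fin 3))) ∈ 𝓝 p := by
      rw [← Prod.mk.eta (p := p)]
      refine prod_mem_nhds (Icc_mem_nhds ?_ ?_) univ_mem
      · linarith [neg_abs_le p.1]
      · linarith [le_abs_self p.1]
    exact (hslab N).continuousAt hmem
  exact continuous_uncurry_of_continuous_stLift hglob

/-! ## §3 The time-Lipschitz bound on `[0, T_c]` -/

/-- Uniform bound of the torus derivative of the slices of a field with smooth space–time lift, on a compact time set. -/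
theorem exists_norm_fderiv_slice_le (hΦ : ContDiff ℝ ∞ (stLift Φ)) {K : Set ℝ} (hK : IsCompact K) :
    ∃ C : ℝ, ∀ τ ∈ K, ∀ x, ‖Torus.fderiv (Φ τ) x‖ ≤ C := by
  obtain ⟨C, hC⟩ := exists_norm_iteratedFDeriv_lift_le_of_isCompact hΦ hK 1
  refine ⟨C, fun τ hτ x => ?_⟩
  have h := hC τ hτ (repr x)
  rw [← norm_iteratedFDeriv_fderiv, norm_iteratedFDeriv_zero, fderiv_lift, proj_repr] at h
  exact h

/-- Uniform bound of the coarse carrier `b_{≤m}` (clause (L3), order `0`). -/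
theorem exists_norm_partialSum_le (E : LagrangianLatticeCarrier k) (hR : E.LevelRegular) (m : ℕ) :
    ∃ C : ℝ, ∀ t' x, ‖E.partialSum m t' x‖ ≤ C := by
  obtain ⟨C, hC⟩ := hR.exists_norm_iteratedFDeriv_partialSum_le m 0
  refine ⟨C, fun t' x => ?_⟩
  have h := hC t' (repr x)
  rw [norm_iteratedFDeriv_zero, lift_apply, proj_repr] at h
  exact h

/-- On `[0, T_c]` the clamp is the identity: the flow time of the frame test is the affine clock `(w + σ₁/a) + (1/a)·τ`. -/
theorem clamp_clock_eq (E : LagrangianLatticeCarrier k) (m : ℕ) {w t σ₁ τ : ℝ} (hσ₁ : 0 ≤ σ₁) (hτ0 : 0 ≤ τ)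
    (hτ : τ ≤ E.a (m + 1) * (t - w) - σ₁) :
    w + max 0 (min (σ₁ + τ) (E.a (m + 1) * (t - w))) / E.a (m + 1) = (w + σ₁ / E.a (m + 1)) + (1 / E.a (m + 1)) * τ := by
  have ha : E.a (m + 1) ≠ 0 := (E.a_pos (m + 1)).ne'
  rw [min_eq_left (by linarith), max_eq_right (by linarith)]
  field_simp
  ring

/-- **The frame test is Lipschitz in time on `[0, T_c]`, uniformly in space** ((C3) `hasDerivAt_test_comp_flow` + the mean value
inequality; constant `sup ‖∂_t Φ‖ + (1/a)·sup ‖∇Φ‖·sup ‖b_{≤m}‖`). -/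
theorem exists_lipschitz_frameTest (E : LagrangianLatticeCarrier k) (hR : E.LevelRegular) {m : ℕ} (hF : E.IsFlow m) {w t σ₁ T : ℝ}
    (hσ₁ : 0 ≤ σ₁) (hT : T = E.a (m + 1) * (t - w) - σ₁) (hΦ : IsSpaceTimeTest T Φ) :
    ∃ L : ℝ, 0 ≤ L ∧ ∀ τ₁ ∈ Icc 0 T, ∀ τ₂ ∈ Icc 0 T, ∀ y : UnitAddTorus (Fin 3),
      ‖Φ τ₁ (E.X m (w + max 0 (min (σ₁ + τ₁) (E.a (m + 1) * (t - w))) / E.a (m + 1)) w y)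
        - Φ τ₂ (E.X m (w + max 0 (min (σ₁ + τ₂) (E.a (m + 1) * (t - w))) / E.a (m + 1)) w y)‖ ≤ L * |τ₁ - τ₂| := by
  obtain ⟨C₁, hC₁⟩ := hΦ.exists_bound_timeDeriv (isCompact_Icc : IsCompact (Icc (0 : ℝ) T))
  obtain ⟨Cd, hCd⟩ := exists_norm_fderiv_slice_le hΦ.1 (isCompact_Icc : IsCompact (Icc (0 : ℝ) T))
  obtain ⟨Cb, hCb⟩ := exists_norm_partialSum_le E hR m
  have ha : 0 < E.a (m + 1) := E.a_pos (m + 1)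
  have hκ : 0 ≤ 1 / E.a (m + 1) := (one_div_pos.2 ha).le
  refine ⟨|C₁| + 1 / E.a (m + 1) * (|Cd| * |Cb|), by positivity, fun τ₁ hτ₁ τ₂ hτ₂ y => ?_⟩
  have hΦ1 : ContDiff ℝ 1 (stLift Φ) := hΦ.1.of_le (by exact_mod_cast le_top)
  -- the honest composite along the affine clock
  set t₀ : ℝ := w + σ₁ / E.a (m + 1) with ht₀
  set g : ℝ → EuclideanSpace ℝ (Fin 3) := fun τ => Φ τ (E.X m (t₀ + 1 / E.a (m + 1) * τ) w y) with hg
  have hgd : ∀ τ ∈ Icc (0 : ℝ) T, HasDerivWithinAt g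
      (Torus.timeDeriv Φ τ (E.X m (t₀ + 1 / E.a (m + 1) * τ) w y) +
        (1 / E.a (m + 1)) • Torus.convect (E.partialSum m (t₀ + 1 / E.a (m + 1) * τ)) (Φ τ) (E.X m (t₀ + 1 / E.a (m + 1) * τ) w y))
      (Icc 0 T) τ :=
    fun τ _ => (hasDerivAt_test_comp_flow E hR hF w t₀ (1 / E.a (m + 1)) hΦ1 τ y).hasDerivWithinAt
  have hbound : ∀ τ ∈ Icc (0 : ℝ) T, ‖Torus.timeDeriv Φ τ (E.X m (t₀ + 1 / E.a (m + 1) * τ) w y) +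
      (1 / E.a (m + 1)) • Torus.convect (E.partialSum m (t₀ + 1 / E.a (m + 1) * τ)) (Φ τ) (E.X m (t₀ + 1 / E.a (m + 1) * τ) w y)‖
      ≤ |C₁| + 1 / E.a (m + 1) * (|Cd| * |Cb|) := by
    intro τ hτ
    refine (norm_add_le _ _).trans (add_le_add ((hC₁ τ hτ _).trans (le_abs_self _)) ?_)
    rw [norm_smul, Real.norm_eq_abs, abs_of_nonneg hκ]
    refine mul_le_mul_of_nonneg_left ?_ hκ
    unfold Torus.convect
    refine (ContinuousLinearMap.le_opNorm _ _).trans ?_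
    exact mul_le_mul ((hCd τ hτ _).trans (le_abs_self _)) ((hCb _ _).trans (le_abs_self _)) (norm_nonneg _) (abs_nonneg _)
  have hMVT := Convex.norm_image_sub_le_of_norm_hasDerivWithin_le hgd hbound (convex_Icc 0 T) hτ₂ hτ₁
  -- the frame test agrees with `g` on `[0, T_c]`
  have hΨg : ∀ τ ∈ Icc (0 : ℝ) T, Φ τ (E.X m (w + max 0 (min (σ₁ + τ) (E.a (m + 1) * (t - w))) / E.a (m + 1)) w y) = g τ :=
    fun τ hτ => by rw [hg, clamp_clock_eq E m hσ₁ hτ.1 (hT ▸ hτ.2)]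
  rw [hΨg τ₁ hτ₁, hΨg τ₂ hτ₂, ← Real.norm_eq_abs]
  exact hMVT

/-! ## §4 The frame test is a time-Lipschitz space-smooth test -/

/-- **(C4) The Eulerian test read in the clamped moving frame is an `IsLipschitzSpaceTimeTest`** on the frame horizon
`T_c = a(t − jR) − σ₁` (piece `[jR, t]` of the closed window, base `σ₁ ≥ 0`). -/
theorem isLipschitzSpaceTimeTest_frameTest (E : LagrangianLatticeCarrier k) (hR : E.LevelRegular) {m : ℕ} (hF : E.IsFlow m) (j : ℤ)
    {t σ₁ T : ℝ} (hjt : (j : ℝ) * E.refresh (m + 1) ≤ t) (htR : t ≤ (j : ℝ) * E.refresh (m + 1) + E.refresh (m + 1))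
    (hσ₁ : 0 ≤ σ₁) (hT : T = E.a (m + 1) * (t - (j : ℝ) * E.refresh (m + 1)) - σ₁) (hΦ : IsSpaceTimeTest T Φ) :
    FluidPDE.Torus.IsLipschitzSpaceTimeTest T (fun τ y => Φ τ (E.X m ((j : ℝ) * E.refresh (m + 1) +
        max 0 (min (σ₁ + τ) (E.a (m + 1) * (t - (j : ℝ) * E.refresh (m + 1)))) / E.a (m + 1)) ((j : ℝ) * E.refresh (m + 1)) y)) := by
  have hΦc : Continuous (uncurry Φ) := continuous_uncurry_of_continuous_stLift hΦ.1.continuous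
  have hiter := continuous_uncurry_iterPartialDeriv_frameTest E hR m j hjt htR σ₁ hΦ.1
  refine ⟨fun τ => isSmooth_frameTest_slice E hR m _ _ (hΦ.isSmooth_slice τ),
    continuous_uncurry_frameTest E hR m _ t σ₁ hΦc, fun i => ?_, fun i i' => ?_, hiter, ?_, ?_⟩
  · simpa only [iterPartialDeriv_cons, iterPartialDeriv_nil] using hiter [i]
  · simpa only [iterPartialDeriv_cons, iterPartialDeriv_nil] using hiter [i, i']
  · exact exists_lipschitz_frameTest E hR hF hσ₁ hT hΦ
  · obtain ⟨T', hT', hzero⟩ := hΦ.2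
    refine ⟨T', hT', fun τ hτ => ?_⟩
    funext y
    rw [hzero τ hτ]
    rfl

/-! ## §5 The frame test satisfies the distorted solenoidal constraint at every frame time -/

/-- **(C1) for the frame test**: if every slice of `Φ` is divergence free, then `∇·(Gcl(σ₁+τ) · Ψ τ) = 0` for EVERY `τ : ℝ`, where
`Gcl` is the clamped frame curve — all flow times lie in the closed piece, where `…FrameClosedPiola` applies. -/
theorem isDivFree_distort_frameTest (E : LagrangianLatticeCarrier k) (hR : E.LevelRegular) {m : ℕ} (hF : E.IsFlow m) (j : ℤ)
    {t : ℝ} (hjt : (j : ℝ) * E.refresh (m + 1) ≤ t) (htR : t ≤ (j : ℝ) * E.refresh (m + 1) + E.refresh (m + 1)) (σ₁ : ℝ)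
    (hΦs : ∀ τ, IsSmooth (Φ τ)) (hdiv : ∀ τ, Torus.IsDivFree (Φ τ)) (τ : ℝ) :
    Torus.IsDivFree (FluidPDE.Torus.distort
      (frameG E m ((j : ℝ) * E.refresh (m + 1) +
        max 0 (min (σ₁ + τ) (E.a (m + 1) * (t - (j : ℝ) * E.refresh (m + 1)))) / E.a (m + 1)) ((j : ℝ) * E.refresh (m + 1)))
      (fun y => Φ τ (E.X m ((j : ℝ) * E.refresh (m + 1) +
        max 0 (min (σ₁ + τ) (E.a (m + 1) * (t - (j : ℝ) * E.refresh (m + 1)))) / E.a (m + 1)) ((j : ℝ) * E.refresh (m + 1)) y))) :=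
  (isDivFree_distort_frameG_iff_closed E hR hF j (T := t - (j : ℝ) * E.refresh (m + 1)) (by linarith)
    (clamp_div_mem E m hjt _) (hΦs τ)).2 (hdiv τ)

end FrameTest

end Summit.AnomalousDissipation.AnomalousDissipation.Theorems.SolenoidalFractalHomogenisation.LagrangianStep.FrameConj

end
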